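import Mathlib
import HarnessLib
import Literature.NumberTheory.LFunctions.WeilGroundEnergyParitySplit
import Literature.NumberTheory.LFunctions.WeilWindowSuzukiProofs
import Literature.NumberTheory.LFunctions.WeilDilationVirial
import Literature.NumberTheory.LFunctions.WeilWindowSuzukiAsymptoticProofs
import Summits.RiemannHypothesis.RiemannHypothesis.Theorems.WeilGroundStateGroundStateSimpleEvenStubParabolaRayleigh
import Summits.RiemannHypothesis.RiemannHypothesis.Theorems.WeilGroundStateArchimedeanWindowSimpleEven
import Summits.RiemannHypothesis.RiemannHypothesis.Theorems.WeilParityEvenWinsArchPhiLipschitz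
import Summits.RiemannHypothesis.RiemannHypothesis.Theorems.WeilParityEvenWinsArchDilationEnergy
import Summits.RiemannHypothesis.RiemannHypothesis.Theorems.WeilParityEvenWinsArchIncrementAverage

/-!
# `EvenWinsArch` — the odd-sector floor by dilation transport

Route `RiemannHypothesis/WeilParity`, crux `EvenWinsArch` (stmt-RiemannHypothesis-15433), line `birth`
(registered skeleton `Cruxes/EvenWinsArch/Lines/birth.lean`), stub `stub_oddFloor`.

**Theorem (`stub_oddFloor`).** With `w = weilArchDensity`, `T(x) = ∫_{Ioi x} w` and `A = (log 2)/2`, for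
every window `0 < a ≤ A`

  `ε_od(a) ≥ 1/20 + 2 (T(2a) − T(2A)) − 2 (sinh a − a) − (A − a)`.

Proof: take an odd normalised test `o` on `[-a, a]` and STRETCH it to the top window,
`õ = weilDilate (a/A − 1) o` (unit norm, odd, supported in `[-A, A]`). The kernel-checked gap certificate
of the tree (`WeilGapCert.weilQuadratic_re_ge_of_checkG weilGapCert_checkG`, `θ = 1/20`) gives
`Re Q(õ) ≥ 1/20`, and `P(õ) ≤ 0` (odd), so `𝓔_A(õ) − M ≥ 1/20` in the Markov decomposition
`Re Q = P + 𝓔 − M‖·‖²` (`M_a = M_A`: no prime below `log 2`). Since `D_t(o) = D_{λt}(õ)`, `λ = A/a`, the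
dilation identity (`stub_dilationEnergy`) and the `c = 1` identity of the tree give
`𝓔_a(o) − 𝓔_A(õ) = −∫_{(0,2A]} (w(u) − w(u/λ)/λ) D_u(õ) du + 2 (T(2a) − T(2A))`, where pointwise
`w(u) − w(u/λ)/λ = (Φ(u) − Φ(u/λ))/u ≤ (1 − 1/λ)/4` (`stub_phiLipschitz`, `Φ(t) = t w(t)`) and
`∫_{(0,2A]} D_u(õ) ≤ 4A` (`stub_incrementAverage`), so the loss is at most `(1 − 1/λ) A = A − a`; finally
`P(o) ≥ −2(sinh a − a)` (Yoshida). Everything is RH-free.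
-/

namespace Summit.RiemannHypothesis.RiemannHypothesis.Theorems.WeilParity.EvenWinsArch

-- `Summit.RiemannHypothesis.RiemannHypothesis.…` repeats a namespace component by design (D-0017 layout).
set_option linter.dupNamespace false

open Set MeasureTheory Filter
open scoped ComplexConjugate
open Literature.NumberTheory.LFunctions
open Summit.RiemannHypothesis.RiemannHypothesis.Theorems.WeilGroundState

/-! ## Small lemmas -/

/-- Odd functions have integral zero. -/
theorem oddFloor_integral_eq_zero_of_odd {g : ℝ → ℂ} (hodd : ∀ t, g (-t) = -g t) :
    ∫ x : ℝ, g x = 0 := by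
  have h1 : ∫ x : ℝ, g (-x) = ∫ x : ℝ, g x := integral_neg_eq_self g volume
  have h2 : ∫ x : ℝ, g (-x) = -∫ x : ℝ, g x := by
    simp_rw [hodd]
    exact integral_neg g
  have h3 : (2 : ℂ) * ∫ x : ℝ, g x = 0 := by
    linear_combination h1.symm.trans h2
  exact (mul_eq_zero.1 h3).resolve_left two_ne_zero

/-- The pole form of an ODD function is non-positive: `∫ o cosh(t/2) = 0`, so
`P(o) = −2 |∫ o sinh(t/2)|² ≤ 0`. -/
theorem oddFloor_weilPoleForm_nonpos_of_odd {g : ℝ → ℂ} (hodd : ∀ t, g (-t) = -g t) :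
    weilPoleForm g ≤ 0 := by
  have h0 : ∫ t : ℝ, g t * (Real.cosh (t / 2) : ℂ) = 0 := by
    refine oddFloor_integral_eq_zero_of_odd fun t ↦ ?_
    rw [hodd, show -t / 2 = -(t / 2) by ring, Real.cosh_neg]
    ring
  unfold weilPoleForm
  rw [h0, norm_zero]
  nlinarith [norm_nonneg (∫ t : ℝ, g t * (Real.sinh (t / 2) : ℂ))]

/-- Composition of dilations with reciprocal factors is the identity:
`weilDilate (c⁻¹ − 1) (weilDilate (c − 1) g) = g` for `c > 0`. -/
theorem oddFloor_weilDilate_inv {c : ℝ} (hc : 0 < c) (g : ℝ → ℂ) :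
    weilDilate (c⁻¹ - 1) (weilDilate (c - 1) g) = g := by
  funext t
  simp only [weilDilate, add_sub_cancel]
  rw [← mul_assoc, ← Complex.ofReal_mul, ← Real.sqrt_mul (inv_pos.2 hc).le, inv_mul_cancel₀ hc.ne',
    Real.sqrt_one, Complex.ofReal_one, one_mul, ← mul_assoc, mul_inv_cancel₀ hc.ne', one_mul]

/-! ## The odd floor -/

/-- **The odd-sector floor by dilation transport (`stub_oddFloor`).** For `0 < a ≤ (log 2)/2`,
`1/20 + 2 (T(2a) − T(log 2)) − 2 (sinh a − a) − ((log 2)/2 − a) ≤ ε_od(a)`,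
`T(x) = ∫_{Ioi x} weilArchDensity`. -/
theorem stub_oddFloor :
    ∀ a : ℝ, 0 < a → a ≤ Real.log 2 / 2 →
      1 / 20 + 2 * ((∫ t in Set.Ioi (2 * a), Literature.NumberTheory.LFunctions.weilArchDensity t) -
            ∫ t in Set.Ioi (Real.log 2), Literature.NumberTheory.LFunctions.weilArchDensity t) -
          2 * (Real.sinh a - a) - (Real.log 2 / 2 - a) ≤
        Literature.NumberTheory.LFunctions.weilOddGroundEnergy a := by
  intro a ha haA
  set A : ℝ := Real.log 2 / 2 with hA
  have hA0 : 0 < A := lt_of_lt_of_le ha haA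
  have h2A : 2 * A = Real.log 2 := by rw [hA]; ring
  refine le_weilOddGroundEnergy_of_forall ha fun o ho hos hodd hon ↦ ?_
  -- the stretch `õ` of `o` to the top window
  set c : ℝ := a / A with hc
  have hc0 : 0 < c := div_pos ha hA0
  have hc1 : c ≤ 1 := (div_le_one hA0).2 haA
  have hη : -1 < c - 1 := by linarith
  set õ : ℝ → ℂ := weilDilate (c - 1) o with hõ
  have hõt : IsWeilTest õ := ho.weilDilate hη
  have hõs : tsupport õ ⊆ Icc (-A) A := by
    have h := tsupport_weilDilate_subset o hη hos
    have e : a / (1 + (c - 1)) = A := by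
      rw [add_sub_cancel, hc]; field_simp
    rwa [e] at h
  have hõodd : ∀ t, õ (-t) = -õ t := fun t ↦ by
    simp only [hõ, weilDilate, mul_neg, hodd, mul_neg]
  have hõn : ∫ t, ‖õ t‖ ^ 2 = 1 := by rw [hõ, integral_norm_sq_weilDilate o hη, hon]
  -- the certificate at the top window: `1/20 ≤ Re Q(õ)`
  have hcert : (1 / 20 : ℝ) ≤ (weilQuadratic õ).re := by
    have hθ := WeilGapCert.weilQuadratic_re_ge_of_checkG weilGapCert_checkG hõt
      (by rwa [hA] at hõs) (Or.inl hõodd)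
    rw [hõn, mul_one, show weilGapCert.theta = 1 / 20 from rfl] at hθ
    push_cast at hθ
    linarith
  -- Markov decompositions
  have hQõ := weilQuadratic_re_eq_weilPoleForm_add_weilDirichletEnergy_sub hõt hõs
  have hQo := weilQuadratic_re_eq_weilPoleForm_add_weilDirichletEnergy_sub ho hos
  rw [hõn, mul_one] at hQõ
  rw [hon, mul_one, Summit.RiemannHypothesis.RiemannHypothesis.Theorems.GroundStateSimpleEven.par_weilMarkovConstant_eq haA,
    ← hA] at hQo
  have hPõ : weilPoleForm õ ≤ 0 := oddFloor_weilPoleForm_nonpos_of_odd hõodd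
  have hPo : -(2 * (Real.sinh a - a)) ≤ weilPoleForm o := by
    have h := Yoshida1992_polar_lower_bound ho hos
    rw [hon, mul_one, two_mul_re_weilMellin_zero_mul_conj_one ho] at h
    exact h
  -- energies: `𝓔_A(õ)` (c = 1 identity) and `𝓔_a(o)` (dilation identity with factor `λ = 1/c`)
  have hEõ : weilDirichletEnergy A õ =
      (∫ u in Ioc 0 (2 * A), weilArchDensity u * weilIncrement õ u) +
        2 * ∫ t in Ioi (2 * A), weilArchDensity t := by
    rw [weilDirichletEnergy_eq_of_two_mul_le_log_two hõt hA0 h2A.le hõs, hõn, mul_one]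
  set lam : ℝ := c⁻¹ with hlam
  have hlam0 : 0 < lam := inv_pos.2 hc0
  have hlam1 : 1 ≤ lam := (one_le_inv₀ hc0).2 hc1
  have ho_eq : o = weilDilate (lam - 1) õ := by rw [hõ, hlam, oddFloor_weilDilate_inv hc0]
  have hDo : ∀ t, weilIncrement o t = weilIncrement õ (lam * t) := fun t ↦ by
    conv_lhs => rw [ho_eq]
    rw [weilIncrement_weilDilate õ (by linarith) t, add_sub_cancel]
  obtain ⟨hIlam, hdil⟩ := stub_dilationEnergy õ A lam hõt hõs hA0 hlam0
  have h2Alam : 2 * A / lam = 2 * a := by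
    rw [hlam, hc, inv_div]; field_simp
  rw [h2Alam, hõn, mul_one] at hdil
  have hEo : weilDirichletEnergy a o =
      (∫ u in Ioc 0 (2 * A), weilArchDensity (u / lam) / lam * weilIncrement õ u) +
        2 * ∫ t in Ioi (2 * a), weilArchDensity t := by
    have hprime : ∑ n ∈ weilPrimeIndex a,
        (ArithmeticFunction.vonMangoldt n : ℝ) / Real.sqrt n * weilIncrement o (Real.log n) = 0 := by
      refine Finset.sum_eq_zero fun n hn ↦ ?_
      rw [mem_weilPrimeIndex] at hn
      rcases Nat.lt_or_ge n 2 with h2 | h2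
      · interval_cases n <;> simp
      · exfalso
        have hlog : Real.log 2 ≤ Real.log n := Real.log_le_log two_pos (by exact_mod_cast h2)
        linarith
    unfold weilDirichletEnergy
    rw [hprime, zero_add, ← hdil]
    exact setIntegral_congr_fun measurableSet_Ioi fun t _ ↦ by rw [hDo t]
  -- the transport loss: `∫ (w(u) − w(u/λ)/λ) D_u(õ) ≤ (1 − 1/λ)/4 · 4A = A − a`
  obtain ⟨hID, havg⟩ := stub_incrementAverage õ A hõt hõs hA0
  rw [hõn, mul_one] at havg
  have hIw : IntegrableOn (fun u ↦ weilArchDensity u * weilIncrement õ u) (Ioc 0 (2 * A)) :=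
    (integrableOn_weilArchDensity_mul_weilIncrement hõt).mono_set Ioc_subset_Ioi_self
  have hloss : (∫ u in Ioc 0 (2 * A), weilArchDensity u * weilIncrement õ u) -
      (∫ u in Ioc 0 (2 * A), weilArchDensity (u / lam) / lam * weilIncrement õ u) ≤ A - a := by
    rw [← integral_sub hIw hIlam]
    have hpt : ∀ u ∈ Ioc (0 : ℝ) (2 * A),
        weilArchDensity u * weilIncrement õ u - weilArchDensity (u / lam) / lam * weilIncrement õ u ≤
          (1 - lam⁻¹) / 4 * weilIncrement õ u := by
      intro u hu
      have hu0 : 0 < u := hu.1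
      have hx0 : 0 < u / lam := div_pos hu0 hlam0
      have hxy : u / lam ≤ u := div_le_self hu0.le hlam1
      have hphi := stub_phiLipschitz (u / lam) u hx0 hxy
      have hD := weilIncrement_nonneg õ u
      -- divide the Φ-inequality by `u > 0`
      have hk : weilArchDensity u - weilArchDensity (u / lam) / lam ≤ (1 - lam⁻¹) / 4 := by
        have e1 : u / lam * weilArchDensity (u / lam) = u * (weilArchDensity (u / lam) / lam) := by
          field_simp
        have e2 : (u - u / lam) / 4 = u * ((1 - lam⁻¹) / 4) := by field_simp
        rw [e1, e2, ← mul_sub] at hphi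
        exact le_of_mul_le_mul_left hphi hu0
      calc weilArchDensity u * weilIncrement õ u - weilArchDensity (u / lam) / lam * weilIncrement õ u
          = (weilArchDensity u - weilArchDensity (u / lam) / lam) * weilIncrement õ u := by ring
        _ ≤ (1 - lam⁻¹) / 4 * weilIncrement õ u := mul_le_mul_of_nonneg_right hk hD
    calc ∫ u in Ioc 0 (2 * A),
          weilArchDensity u * weilIncrement õ u - weilArchDensity (u / lam) / lam * weilIncrement õ u
        ≤ ∫ u in Ioc 0 (2 * A), (1 - lam⁻¹) / 4 * weilIncrement õ u :=
          setIntegral_mono_on (hIw.sub hIlam) (hID.const_mul _) measurableSet_Ioc hpt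
      _ = (1 - lam⁻¹) / 4 * ∫ u in Ioc 0 (2 * A), weilIncrement õ u := integral_const_mul _ _
      _ ≤ (1 - lam⁻¹) / 4 * (4 * A) :=
          mul_le_mul_of_nonneg_left havg (by
            have : lam⁻¹ ≤ 1 := inv_le_one_of_one_le₀ hlam1
            linarith)
      _ = A - a := by
          rw [hlam, inv_inv, hc]
          field_simp
  -- assemble
  have hgoal : 1 / 20 + 2 * ((∫ t in Ioi (2 * a), weilArchDensity t) - ∫ t in Ioi (Real.log 2),
      weilArchDensity t) - 2 * (Real.sinh a - a) - (A - a) ≤ (weilQuadratic o).re := by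
    rw [← h2A]
    rw [hQo, hEo]
    rw [hQõ, hEõ] at hcert
    linarith
  exact hgoal

end Summit.RiemannHypothesis.RiemannHypothesis.Theorems.WeilParity.EvenWinsArch
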